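import Summits.FinalStateConjecture.FinalStateConjecture.Theorems.StarvedNecksNecksCertifyRRelations

/-!
# `GapDecaySuffices` (crux stmt-FinalStateConjecture-18060, route StarvedNecks) — negative side:
# the stub `PosCore` behind the advertised proof is false modulo a label-swapped honest binary

Refuter seat `refuter-cdisprove-stmt-FinalStateConjecture-18060-0` (crux disprover, cycle 1), 2026-08-17.
Sorry-free; axioms `propext`, `Classical.choice`, `Quot.sound`.  Theorems-side copy of §1–§3 of the crux
work file `Cruxes/GapDecaySuffices/Disproof.lean` (full findings, the typed repair `TubeAnchored`, and the
record of the other attacks live there).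

The crux `GapDecaySuffices := NeckGapDecay → NecksCertifyR` is advertised (route text, item -18060) as
provable now by `PosSoft ∘ p131681`: the landed `necksCertifyR_of_neckLedgerAnalysisPos`
(`Theorems/StarvedNecksNecksCertifyRRelations.lean`) needs, for EVERY honest `C⁴` input with pairwise
distinct label velocities and `0 < d.N`, a `NeckCertificate` (K1–K12 of the v5 skeleton); `PosSoft` is to
build it from the gap certificates of `NeckGapDecay` for the same input.  This file records:

* `PosCore` — that hypothesis with its two proved model antecedents dropped (the registered physics stub
  `stub_neckLedgerAnalysisPos` of `Cruxes/NecksCertify/Lines/two_cap_focusing_ledger.lean`, bundles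
  verbatim those of p131681);
* `LabelSwapWitness` (`H_swap`) — an honest input satisfying the antecedent of `PosCore` with NO
  `NeckCertificate`; intended inhabitant (docstring): ANY honest non-comoving two-hole input read through
  the model Poincaré involution that swaps its two label lines — the antecedent (`FinalStateDecomposition`,
  `O = exteriorOf`, `Hc`, `Hf`, DV) is covariant under such relabellings, `NeckCertificate` (K5 pins
  `Ψₐᵢ` to the input hole chart `i`, K6 pins `Ψₐᵢ = Φ` at the same MODEL points around label line `i`)
  is not;
* `posCore_false_of_labelSwapWitness : H_swap → ¬ PosCore`, `labelSwapWitness_iff_not_posCore`;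
* the model-space covariance identities that make the relabelling exact at the level of the boosted
  Kerr–Schild labels: `poincareInv_relabel`, `boostedKerr_time_relabel`, `boostedKerr_radius_relabel`,
  `mem_boostedKerrExterior_relabel`, `boostedKerrBilin_relabel`.

No route decl is concluded, positively or negatively: `GapDecaySuffices` itself is NOT refuted
(`NecksCertifyR`'s `∃ d₂` may un-permute the labels), but its only registered proof path needs `PosCore`,
which this witness kills exactly as `ComovingPairWitness` (p121147) killed the rev-1 `NecksCertify` — and,
unlike that witness, this one survives the rev-3 repair (DV on labels).  References: route file
`Theses/StarvedNecks.lean` rev 7; v5 skeleton docstring of `NeckCertificate` (l. 558–560: "without DV,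
K6/K7 already fail for a comoving binary (the other hole sits inside the collar)"); O'Neill 1983, Ch. 9
(Lorentz/Poincaré group); Kerr–Schild 1965 (Lorentz covariance of the ansatz); Dafermos–Luk
arXiv:1710.01722 §1.2.1.
-/

noncomputable section

open scoped Manifold ContDiff Topology ENNReal
open Filter Set MeasureTheory Topology Literature.Geometry.Lorentzian

namespace Summit.FinalStateConjecture.FinalStateConjecture.Theorems.GapDecaySuffices.Negative

set_option linter.dupNamespace false

/-- **`PosCore`** — the hypothesis of the landed reduction `necksCertifyR_of_neckLedgerAnalysisPos`
(p131681) with its two PROVED model antecedents (`HuygensNeckLemma`, `KirchhoffFormula`) dropped: for every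
admissible datum, MGHD, honest `C⁴` input (`O = exteriorOf`, `HonestCore`, `HonestFar`, bundles VERBATIM
those of p131681) with pairwise distinct LABEL velocities and `0 < d.N`, a `NeckCertificate` (K1–K12).
Statement of the registered stub `stub_neckLedgerAnalysisPos` (v5 skeleton) minus the model antecedents;
the TARGET of the planner's `PosSoft` for crux stmt-FinalStateConjecture-18060.
[topic: Summits/FinalStateConjecture/FinalStateConjecture — neck certificate of an honest multi-hole input] -/
def PosCore : Prop :=
    let HonestCore := fun (𝓢 : Spacetime.{0} 4) (O : Set 𝓢.carrier) (k : ℕ)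
        (d : FinalStateDecomposition 𝓢 O k) (R₀ : ℝ) ↦
      let B := d.background; let t := fun i ↦ (B i).time; let r := fun i ↦ (B i).radius; let Ψ := d.chart;
      (∀ i, Kerr.IsSubextremal (d.mass i) (d.spin i) ∧ 100 * d.mass i ≤ R₀ ∧ 0 < ((d.motion i).1 : E4 ≃L[ℝ] E4) (E4.basisVector 0) 0) ∧
        (∀ i (ϱ τ₂ : ℝ), R₀ ≤ ϱ → d.τ₀ < τ₂ → Ψ i '' {x | d.τ₀ < t i x.1 ∧ t i x.1 < τ₂ ∧ r i x.1 < ϱ} ⊆ 𝓢.metric.causalPast 𝓢.timeOrientation (Ψ i '' (B i).truncTimeSlab ϱ τ₂)) ∧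
        (∀ i (τ' : ℝ) (ϱ : ℝ → ℝ), Continuous ϱ → d.τ₀ < τ' → let A := Ψ i '' {x | τ' ≤ t i x.1 ∧ r i x.1 ≤ ϱ (t i x.1)}; closure A ∩ O ⊆ A) ∧
        (∀ y : d.flatDomain, d.τ₀ < y.1 0 → 𝓢.timeOrientation.IsFutureDirected (mfderiv 𝓘(ℝ, E4) (𝓡 4) d.flatChart y (E4.basisVector 0)))
    let HonestFar := fun (𝓢 : Spacetime.{0} 4) (O : Set 𝓢.carrier) (k : ℕ)
        (d : FinalStateDecomposition 𝓢 O k) (R₀ : ℝ) ↦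
      let B := d.background; let t := fun i ↦ (B i).time; let r := fun i ↦ (B i).radius; let Φ := d.flatChart;
      (∀ τ₂ : ℝ, d.τ₀ < τ₂ → Φ '' {y | d.τ₀ < y.1 0 ∧ y.1 0 < τ₂} ⊆ 𝓢.metric.causalPast 𝓢.timeOrientation (Φ '' (Minkowski.backgroundOn d.flatDomain).timeSlab τ₂)) ∧
        (∀ τ' : ℝ, d.τ₀ < τ' → closure (Φ '' {y | τ' ≤ y.1 0 ∧ ∀ i, d.excision i (y.1 0) + 1 ≤ r i y.1}) ⊆ Φ '' {y | τ' ≤ y.1 0}) ∧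
        (∀ i, ∃ T : ℝ, supCkENorm (Subtype.val '' {x : (B i).domain | T ≤ t i x.1 ∧ R₀ ≤ r i x.1 ∧ ∀ j, j ≠ i → r i x.1 ≤ r j x.1}) 0 (𝓢.deviationExtend (B i) (d.chart i)) ≤ ENNReal.ofReal (1 / (10 * ‖(((d.motion i).1 : E4 ≃L[ℝ] E4) : E4 →L[ℝ] E4)‖ ^ 2)))
    let NeckCertificate := fun (𝓢 : Spacetime.{0} 4) (O : Set 𝓢.carrier) (d : FinalStateDecomposition 𝓢 O 4)
        (R₀ : ℝ) ↦
      let B := d.background; let t := fun i ↦ (B i).time; let r := fun i ↦ (B i).radius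
      let Λ := fun i ↦ ((d.motion i).1 : E4 ≃L[ℝ] E4); let Φ := d.flatChart; let Ψ := d.chart
      let ρ := d.excision
      ∃ (R₁ τ₁ : ℝ) (ρa Rc : Fin d.N → ℝ → ℝ) (Ψa : ∀ i, (B i).domain → 𝓢.carrier),
        R₀ ≤ R₁ ∧ d.τ₀ ≤ τ₁ ∧
        (∀ i, Monotone (ρa i) ∧ Continuous (ρa i) ∧ Tendsto (fun s ↦ ρa i s / s) atTop (𝓝 0) ∧
          Tendsto (ρa i) atTop atTop ∧ ∀ s, R₁ + 1 ≤ ρa i s ∧ (τ₁ ≤ s → ρ i s + 1 ≤ ρa i s)) ∧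
        (∀ i, Monotone (Rc i) ∧ Continuous (Rc i) ∧ Tendsto (fun s ↦ Rc i s / s) atTop (𝓝 0) ∧
          Tendsto (Rc i) atTop atTop ∧ ∀ s, R₁ + 4 ≤ Rc i s) ∧
        (∀ j (y : E4), τ₁ ≤ y 0 → r j y ≤ 9 * ρa j (y 0) → r j y + 3 ≤ Rc j (t j y)) ∧
        (∀ i, let U : Set (B i).domain := {x | τ₁ < t i x.1 ∧ r i x.1 < Rc i (t i x.1) + 2}
          ContMDiffOn 𝓘(ℝ, E4) (𝓡 4) ∞ (Ψa i) U ∧ IsOpenEmbedding (U.restrict (Ψa i)) ∧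
            Ψa i '' U ⊆ d.charted) ∧
        (∀ i (x : (B i).domain), r i x.1 ≤ R₁ + 1 → Ψa i x = Ψ i x) ∧
        (∀ i (y : E4) (hy : y ∈ (B i).domain), τ₁ ≤ y 0 → 4 * ρa i (y 0) ≤ r i y →
          r i y ≤ Rc i (t i y) + 2 → ∃ hy' : y ∈ d.flatDomain, Ψa i ⟨y, hy⟩ = Φ ⟨y, hy'⟩) ∧
        (∀ i, Tendsto (fun τ ↦ 𝓢.truncDeviationCk (B i) (Ψa i) 2 (Rc i τ) τ) atTop (𝓝 0)) ∧
        (∀ i, supCkENorm (Subtype.val '' {x : (B i).domain | τ₁ ≤ t i x.1 ∧ R₁ ≤ r i x.1 ∧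
            r i x.1 ≤ Rc i (t i x.1) + 2}) 0 (𝓢.deviationExtend (B i) (Ψa i)) ≤
          ENNReal.ofReal (1 / (10 * ‖(Λ i : E4 →L[ℝ] E4)‖ ^ 2))) ∧
        (∀ i (x : (B i).domain), τ₁ ≤ t i x.1 → R₁ ≤ r i x.1 → r i x.1 ≤ Rc i (t i x.1) + 2 →
          𝓢.timeOrientation.IsFutureDirected
            (mfderiv 𝓘(ℝ, E4) (𝓡 4) (Ψa i) x ((Λ i) (E4.basisVector 0)))) ∧
        (∀ i j, i ≠ j → Disjoint (Ψa i '' {x | τ₁ < t i x.1 ∧ r i x.1 < Rc i (t i x.1) + 2})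
          (Ψa j '' {x | τ₁ < t j x.1 ∧ r j x.1 < Rc j (t j x.1) + 2})) ∧
        (∀ i (τ' : ℝ) (ϱ : ℝ → ℝ), Continuous ϱ → τ₁ < τ' → (∀ s, ϱ s < Rc i s + 2) →
          closure (Ψa i '' {x | τ' ≤ t i x.1 ∧ r i x.1 ≤ ϱ (t i x.1)}) ∩ O ⊆
            Ψa i '' {x | τ' ≤ t i x.1 ∧ r i x.1 ≤ ϱ (t i x.1)}) ∧
        (∀ (T : ℝ) (Th : Fin d.N → ℝ), τ₁ < T → (∀ j, τ₁ < Th j) →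
          (∀ j (y : E4), T < y 0 → r j y ≤ Rc j (t j y) + 2 → Th j < t j y) →
          O \ (Φ '' {y | T < y.1 0 ∧ ∀ j, 5 * ρa j (y.1 0) < r j y.1} ∪
              ⋃ j, Ψa j '' {x | Th j < t j x.1 ∧ r j x.1 < Rc j (t j x.1) + 2}) ⊆
            𝓢.metric.causalPast 𝓢.timeOrientation
              (Φ '' {y | y.1 0 = T ∧ ∀ j, 5 * ρa j (y.1 0) < r j y.1} ∪
                ⋃ j, Ψa j '' {x | t j x.1 = Th j ∧ r j x.1 < Rc j (t j x.1) + 2}))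
      ∀ (X : Type) [TopologicalSpace X] [ChartedSpace E3 X] [IsManifold (𝓡 3) ∞ X] [ConnectedSpace X]
        (D : InitialDataSet (𝓡 3) X), D ∈ admissibleVacuumData X →
        ∀ 𝒟 : VacuumCauchyDevelopment D, 𝒟.IsMaximal →
        ∀ (O : Set 𝒟.carrier) (d : FinalStateDecomposition 𝒟.toSpacetime O 4) (R₀ : ℝ),
          O = exteriorOf 𝒟.toCauchyDevelopment d.charted →
          HonestCore 𝒟.toSpacetime O 4 d R₀ → HonestFar 𝒟.toSpacetime O 4 d R₀ →
          (∀ i j : Fin d.N, i ≠ j →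
            ((d.motion i).1 : E4 ≃L[ℝ] E4) (E4.basisVector 0) ≠ ((d.motion j).1 : E4 ≃L[ℝ] E4) (E4.basisVector 0)) →
          0 < d.N → NeckCertificate 𝒟.toSpacetime O d R₀

/-- **Hypothesis `H_swap` (physics-level; not constructible in the tree): a label-swapped honest
binary.**  With the bundles VERBATIM those of `PosCore`: there are an admissible datum, an MGHD, and an
honest `C⁴` input (`O = exteriorOf`, `HonestCore`, `HonestFar`, pairwise distinct label velocities,
`0 < d.N`) admitting NO `NeckCertificate`.

INTENDED INHABITANT (paper; clause-by-clause check in this docstring).  Start from ANY honest two-hole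
input `(Ψ_A, Ψ_B, Φ)` — labels `(Λ_A,c_A)`, `(Λ_B,c_B)` with distinct velocities, tubes `ρ_A, ρ_B`
continuous, hole charts covering their dark tube interiors and C⁰-honest on their Voronoi cells with
deviation → 0 there (slack), no garbage beyond — i.e. what the final state conjecture predicts for
non-comoving two-hole data.  Let `P x = L x + p` be a proper orthochronous Poincaré INVOLUTION of the
model space with `P ℓ_A = ℓ_B` (hence `P ℓ_B = ℓ_A`); one exists for any two timelike lines with
distinct velocities: in the centre-of-velocity frame (velocities `±w ê_x`) rotate by `π` about an axis
`n ⊥ ê_x`, `n ⊥ (a_⊥ − b_⊥)`, through the midpoint `m = (a+b)/2`.  `P` is an exact `η`-isometry, so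
rest-frame distances to the lines are preserved: `r_A ∘ P = r_B ± (|a_A|+|a_B|)` (oblate-radius slack
only).  SWAPPED INPUT `d_sw`: `N = 2`, same masses/spins, motions `(L⁻¹Λ_A, L⁻¹(c_A − p))` and
`(L⁻¹Λ_B, L⁻¹(c_B − p))`, charts `Ψ₁ := Ψ_A ∘ P`, `Ψ₂ := Ψ_B ∘ P` (domains `P⁻¹(dom_A)`, `P⁻¹(dom_B)`
by `mem_boostedKerrExterior_relabel` below), the SAME flat chart `Φ`, flat domain and `τ₀`, excisions
`ρ₁ := ρ_B + C`, `ρ₂ := ρ_A + C` (`C` = spin-mismatch slack of the oblate radius).  By the covariance lemmas below,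
`t₁ = t_A ∘ P`, `r₁ = r_A ∘ P` and `B₁.bilin x (v,w) = B_A.bilin (P x) (L v, L w)`, so: every model set
`{τ₀ < t₁ < τ₂, r₁ < ϱ}`, `truncTimeSlab`, `lateRegion`, `timeSlab` of label 1 is the `P`-preimage of
the corresponding set of `A`, and its `Ψ₁`-image is the `Ψ_A`-image of `A`'s set — IDENTICAL physical
sets.  Hence: `isLateChart` ✓ (smooth ∘ affine; open embedding; same image), near-zone `C⁴` convergence ✓
(`dev₁ = (L×L)^* dev_A ∘ P`, jets bounded by `‖L‖^{m+2}`·jets of `dev_A`), `exists_pairwise_disjoint` ✓,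
`tendsto_excision_div` ✓, `setOf_lt_excision_subset_flatDomain` ✓ (the label lines are `{ℓ_B, ℓ_A}`, the
new tubes contain the old), flat clauses and covering clause ✓ (unchanged sets), `O = exteriorOf` ✓
(`charted` unchanged), `Hc`(1) ✓ (`L⁻¹` proper orthochronous), `Hc`(2)(3) ✓ (identical image sets),
`Hc`(4), `Hf`(1)(2) ✓ (flat chart unchanged; `{∀ i, ρᵢ+1 ≤ rᵢ}` shrinks), `Hf`(3) ✓ — the Voronoi cell
`{R₀ ≤ r₁ ≤ r₂}` is EXACTLY `P⁻¹` of `A`'s true cell `{R₀ ≤ r_A ≤ r_B}` (because `P` swaps the two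
lines), `Ψ₁` there is `Ψ_A` on its own cell, and `‖dev₁‖ ≤ ‖L‖² ‖dev_A ∘ P‖ ≤ 1/(10‖L⁻¹Λ_A‖²)`
eventually by the slack; DV ✓ (`L⁻¹Λ_A e₀ ∦ L⁻¹Λ_B e₀`).  So `d_sw` satisfies the antecedent of
`PosCore` verbatim — it is the honest input read through a symmetry of `η` that the typed clauses cannot
see.  WHY NO `NeckCertificate(d_sw)`: K5 gives `Ψₐ₁ = Ψ₁ = Ψ_A ∘ P` on `{r₁ ≤ R₁+1}` — physically hole
`A`; K6 gives `Ψₐ₁ y = Φ y` for model `y` with `4ρₐ₁(y⁰) ≤ r₁ y ≤ Rc₁+2` — model points near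
`ℓ₁ = ℓ_B`, physically the flat collar around hole `B`; K4/K7/K8 make `Ψₐ₁` a `C⁰`-honest (10 %)
embedding of the CONNECTED model tube `{τ₁ < t₁, r₁ < Rc₁+2}` of radius `Rc₁+2 = o(t)` whose image
therefore has lab extent `o(t)` around `B`'s collar while containing `A`'s near zone at lab distance
`≍ |u_A − u_B| t` — impossible for late slabs (the bridge cannot dive to flat times `< τ₁` either: clock
distortion along a C⁰-honest slab piece of model diameter `o(t)` is `o(t)`).  Sharper, via K10: follow
the `Ψₐ₁`-image of a model radial segment from `r₁ = R₁+1` to `r₁ = 4ρₐ₁`; its last exit from the dark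
tube of `A` enters `Φ(late)` through `A`'s tube wall (`r_A ≈ ρ_A+1 < 4ρₐ₂`) and ends at `r_A ≍ ct >
9ρₐ₂`, so by the IVT it meets `Φ({4ρₐ₂ ≤ r₂ ≤ 9ρₐ₂})`, which K6 FOR LABEL 2 (`ℓ₂ = ℓ_A`) and K3 place
inside `Ψₐ₂(U₂)` — contradicting K10.  (D) WHAT THE ANTECEDENT DOES PIN (paper): tube containment
(flat `C⁴` certification vs. Kerr curvature) forces the SET of physical asymptotic velocities into the SET
of label velocities, and `Hf`(3) on Voronoi cells forbids a chart's honest region to contain a companion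
(no-dodging, Jordan–Brouwer in the slab), which makes the hole ↦ tube assignment a PERMUTATION `σ`
compatible with the velocity configuration up to the factor ≈ 0.35 of the 10 % threshold — for `N = 2`
no constraint at all.  `σ = id` is NOT forced: that is the content of this witness.

WHY `H_swap` IS NOT CONSTRUCTIBLE HERE: it needs an admissible datum WITH a maximal vacuum Cauchy
development carrying two receding holes and honest charts (no two-black-hole MGHD is constructed in
print, let alone in the tree; in Minkowski space every honest decomposition has `N = 0`), exactly as for
the landed `…NecksCertify.Negative.ComovingPairWitness` (p121147).  Unlike that witness, this one
SURVIVES the rev-3 repair C′ (DV on labels) and every clause of rev 5–7.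
[topic: Summits/FinalStateConjecture/FinalStateConjecture — multi-black-hole chart kinematics, label gauge] -/
def LabelSwapWitness : Prop :=
    let HonestCore := fun (𝓢 : Spacetime.{0} 4) (O : Set 𝓢.carrier) (k : ℕ)
        (d : FinalStateDecomposition 𝓢 O k) (R₀ : ℝ) ↦
      let B := d.background; let t := fun i ↦ (B i).time; let r := fun i ↦ (B i).radius; let Ψ := d.chart;
      (∀ i, Kerr.IsSubextremal (d.mass i) (d.spin i) ∧ 100 * d.mass i ≤ R₀ ∧ 0 < ((d.motion i).1 : E4 ≃L[ℝ] E4) (E4.basisVector 0) 0) ∧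
        (∀ i (ϱ τ₂ : ℝ), R₀ ≤ ϱ → d.τ₀ < τ₂ → Ψ i '' {x | d.τ₀ < t i x.1 ∧ t i x.1 < τ₂ ∧ r i x.1 < ϱ} ⊆ 𝓢.metric.causalPast 𝓢.timeOrientation (Ψ i '' (B i).truncTimeSlab ϱ τ₂)) ∧
        (∀ i (τ' : ℝ) (ϱ : ℝ → ℝ), Continuous ϱ → d.τ₀ < τ' → let A := Ψ i '' {x | τ' ≤ t i x.1 ∧ r i x.1 ≤ ϱ (t i x.1)}; closure A ∩ O ⊆ A) ∧
        (∀ y : d.flatDomain, d.τ₀ < y.1 0 → 𝓢.timeOrientation.IsFutureDirected (mfderiv 𝓘(ℝ, E4) (𝓡 4) d.flatChart y (E4.basisVector 0)))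
    let HonestFar := fun (𝓢 : Spacetime.{0} 4) (O : Set 𝓢.carrier) (k : ℕ)
        (d : FinalStateDecomposition 𝓢 O k) (R₀ : ℝ) ↦
      let B := d.background; let t := fun i ↦ (B i).time; let r := fun i ↦ (B i).radius; let Φ := d.flatChart;
      (∀ τ₂ : ℝ, d.τ₀ < τ₂ → Φ '' {y | d.τ₀ < y.1 0 ∧ y.1 0 < τ₂} ⊆ 𝓢.metric.causalPast 𝓢.timeOrientation (Φ '' (Minkowski.backgroundOn d.flatDomain).timeSlab τ₂)) ∧
        (∀ τ' : ℝ, d.τ₀ < τ' → closure (Φ '' {y | τ' ≤ y.1 0 ∧ ∀ i, d.excision i (y.1 0) + 1 ≤ r i y.1}) ⊆ Φ '' {y | τ' ≤ y.1 0}) ∧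
        (∀ i, ∃ T : ℝ, supCkENorm (Subtype.val '' {x : (B i).domain | T ≤ t i x.1 ∧ R₀ ≤ r i x.1 ∧ ∀ j, j ≠ i → r i x.1 ≤ r j x.1}) 0 (𝓢.deviationExtend (B i) (d.chart i)) ≤ ENNReal.ofReal (1 / (10 * ‖(((d.motion i).1 : E4 ≃L[ℝ] E4) : E4 →L[ℝ] E4)‖ ^ 2)))
    let NeckCertificate := fun (𝓢 : Spacetime.{0} 4) (O : Set 𝓢.carrier) (d : FinalStateDecomposition 𝓢 O 4)
        (R₀ : ℝ) ↦
      let B := d.background; let t := fun i ↦ (B i).time; let r := fun i ↦ (B i).radius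
      let Λ := fun i ↦ ((d.motion i).1 : E4 ≃L[ℝ] E4); let Φ := d.flatChart; let Ψ := d.chart
      let ρ := d.excision
      ∃ (R₁ τ₁ : ℝ) (ρa Rc : Fin d.N → ℝ → ℝ) (Ψa : ∀ i, (B i).domain → 𝓢.carrier),
        R₀ ≤ R₁ ∧ d.τ₀ ≤ τ₁ ∧
        (∀ i, Monotone (ρa i) ∧ Continuous (ρa i) ∧ Tendsto (fun s ↦ ρa i s / s) atTop (𝓝 0) ∧
          Tendsto (ρa i) atTop atTop ∧ ∀ s, R₁ + 1 ≤ ρa i s ∧ (τ₁ ≤ s → ρ i s + 1 ≤ ρa i s)) ∧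
        (∀ i, Monotone (Rc i) ∧ Continuous (Rc i) ∧ Tendsto (fun s ↦ Rc i s / s) atTop (𝓝 0) ∧
          Tendsto (Rc i) atTop atTop ∧ ∀ s, R₁ + 4 ≤ Rc i s) ∧
        (∀ j (y : E4), τ₁ ≤ y 0 → r j y ≤ 9 * ρa j (y 0) → r j y + 3 ≤ Rc j (t j y)) ∧
        (∀ i, let U : Set (B i).domain := {x | τ₁ < t i x.1 ∧ r i x.1 < Rc i (t i x.1) + 2}
          ContMDiffOn 𝓘(ℝ, E4) (𝓡 4) ∞ (Ψa i) U ∧ IsOpenEmbedding (U.restrict (Ψa i)) ∧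
            Ψa i '' U ⊆ d.charted) ∧
        (∀ i (x : (B i).domain), r i x.1 ≤ R₁ + 1 → Ψa i x = Ψ i x) ∧
        (∀ i (y : E4) (hy : y ∈ (B i).domain), τ₁ ≤ y 0 → 4 * ρa i (y 0) ≤ r i y →
          r i y ≤ Rc i (t i y) + 2 → ∃ hy' : y ∈ d.flatDomain, Ψa i ⟨y, hy⟩ = Φ ⟨y, hy'⟩) ∧
        (∀ i, Tendsto (fun τ ↦ 𝓢.truncDeviationCk (B i) (Ψa i) 2 (Rc i τ) τ) atTop (𝓝 0)) ∧
        (∀ i, supCkENorm (Subtype.val '' {x : (B i).domain | τ₁ ≤ t i x.1 ∧ R₁ ≤ r i x.1 ∧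
            r i x.1 ≤ Rc i (t i x.1) + 2}) 0 (𝓢.deviationExtend (B i) (Ψa i)) ≤
          ENNReal.ofReal (1 / (10 * ‖(Λ i : E4 →L[ℝ] E4)‖ ^ 2))) ∧
        (∀ i (x : (B i).domain), τ₁ ≤ t i x.1 → R₁ ≤ r i x.1 → r i x.1 ≤ Rc i (t i x.1) + 2 →
          𝓢.timeOrientation.IsFutureDirected
            (mfderiv 𝓘(ℝ, E4) (𝓡 4) (Ψa i) x ((Λ i) (E4.basisVector 0)))) ∧
        (∀ i j, i ≠ j → Disjoint (Ψa i '' {x | τ₁ < t i x.1 ∧ r i x.1 < Rc i (t i x.1) + 2})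
          (Ψa j '' {x | τ₁ < t j x.1 ∧ r j x.1 < Rc j (t j x.1) + 2})) ∧
        (∀ i (τ' : ℝ) (ϱ : ℝ → ℝ), Continuous ϱ → τ₁ < τ' → (∀ s, ϱ s < Rc i s + 2) →
          closure (Ψa i '' {x | τ' ≤ t i x.1 ∧ r i x.1 ≤ ϱ (t i x.1)}) ∩ O ⊆
            Ψa i '' {x | τ' ≤ t i x.1 ∧ r i x.1 ≤ ϱ (t i x.1)}) ∧
        (∀ (T : ℝ) (Th : Fin d.N → ℝ), τ₁ < T → (∀ j, τ₁ < Th j) →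
          (∀ j (y : E4), T < y 0 → r j y ≤ Rc j (t j y) + 2 → Th j < t j y) →
          O \ (Φ '' {y | T < y.1 0 ∧ ∀ j, 5 * ρa j (y.1 0) < r j y.1} ∪
              ⋃ j, Ψa j '' {x | Th j < t j x.1 ∧ r j x.1 < Rc j (t j x.1) + 2}) ⊆
            𝓢.metric.causalPast 𝓢.timeOrientation
              (Φ '' {y | y.1 0 = T ∧ ∀ j, 5 * ρa j (y.1 0) < r j y.1} ∪
                ⋃ j, Ψa j '' {x | t j x.1 = Th j ∧ r j x.1 < Rc j (t j x.1) + 2}))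
    ∃ (X : Type) (_ : TopologicalSpace X) (_ : ChartedSpace E3 X) (_ : IsManifold (𝓡 3) ∞ X)
      (_ : ConnectedSpace X) (D : InitialDataSet (𝓡 3) X) (_ : D ∈ admissibleVacuumData X)
      (𝒟 : VacuumCauchyDevelopment D) (_ : 𝒟.IsMaximal)
      (O : Set 𝒟.carrier) (d : FinalStateDecomposition 𝒟.toSpacetime O 4) (R₀ : ℝ),
      O = exteriorOf 𝒟.toCauchyDevelopment d.charted ∧
      HonestCore 𝒟.toSpacetime O 4 d R₀ ∧ HonestFar 𝒟.toSpacetime O 4 d R₀ ∧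
      (∀ i j : Fin d.N, i ≠ j →
        ((d.motion i).1 : E4 ≃L[ℝ] E4) (E4.basisVector 0) ≠ ((d.motion j).1 : E4 ≃L[ℝ] E4) (E4.basisVector 0)) ∧
      0 < d.N ∧ ¬ NeckCertificate 𝒟.toSpacetime O d R₀

/-- **NEGATIVE LEMMA MODULO `H_swap`: the registered stub / the hypothesis of p131681 is false as soon as
a label-swapped honest binary exists** — `LabelSwapWitness → ¬ PosCore`.  Apply `PosCore` to the witness
input. [folklore] -/
theorem posCore_false_of_labelSwapWitness (hH : LabelSwapWitness) : ¬ PosCore := by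
  intro hPos
  obtain ⟨X, i₁, i₂, i₃, i₄, D, hD, 𝒟, h𝒟, O, d, R₀, hO, hc, hf, hDV, hN, hno⟩ := hH
  exact hno (hPos X D hD 𝒟 h𝒟 O d R₀ hO hc hf hDV hN)

/-- Honesty about the hold: `H_swap` is the WEAKEST hypothesis refuting `PosCore` —
`LabelSwapWitness ↔ ¬ PosCore`; the content is the paper inhabitant of the docstring of
`LabelSwapWitness`, not this equivalence. [folklore] -/
theorem labelSwapWitness_iff_not_posCore : LabelSwapWitness ↔ ¬ PosCore := by
  refine ⟨posCore_false_of_labelSwapWitness, fun h ↦ ?_⟩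
  by_contra hW
  refine h ?_
  intro X i₁ i₂ i₃ i₄ D hD 𝒟 h𝒟 O d R₀ hO hc hf hDV hN
  by_contra hno
  exact hW ⟨X, i₁, i₂, i₃, i₄, D, hD, 𝒟, h𝒟, O, d, R₀, hO, hc, hf, hDV, hN, hno⟩

/-! ## Model-space covariance of the boosted Kerr–Schild labels under a Poincaré relabelling

`P x = L x + p` with `L ∈ lorentzGroup`: the label `(L⁻¹Λ, L⁻¹(c − p))` has rest-frame coordinates
`poincareInv` equal to those of `(Λ, c)` AFTER `P`; hence time, radius, exterior domain and reference
form all transform by precomposition with `P` (the form also by `(L × L)`-pullback).  These five identities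
are the whole formal content of "relabelling covariance" at the level of the backgrounds; the chart-level
statements (docstring of `LabelSwapWitness`) are their compositions with `Ψ ∘ P`. -/

section Covariance

variable (Λ L : lorentzGroup) (c p : E4)

/-- Group law of `lorentzGroup ≤ (E4 ≃L[ℝ] E4)` (automorphism group: `(f * g) v = f (g v)`,
`f⁻¹ = f.symm`) applied to rest-frame coordinates: the relabelled inverse Poincaré map is the old one
after `P`.  O'Neill 1983, Ch. 9, p. 236. [cite: ONeill1983, Ch. 9  p. 236] -/
theorem poincareInv_relabel (x : E4) :
    poincareInv (L⁻¹ * Λ) ((L : E4 ≃L[ℝ] E4).symm (c - p)) x =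
      poincareInv Λ c ((L : E4 ≃L[ℝ] E4) x + p) := by
  simp only [poincareInv]
  have h1 : ∀ u : E4, (((L⁻¹ * Λ : lorentzGroup) : E4 ≃L[ℝ] E4).symm) u =
      (Λ : E4 ≃L[ℝ] E4).symm ((L : E4 ≃L[ℝ] E4) u) := fun u ↦ rfl
  have h2 : (L : E4 ≃L[ℝ] E4) ((L : E4 ≃L[ℝ] E4).symm (c - p)) = c - p :=
    (L : E4 ≃L[ℝ] E4).apply_symm_apply (c - p)
  rw [h1, map_sub, h2]
  congr 1
  abel

/-- Rest-frame time of the relabelled background = old rest-frame time after `P`. [folklore] -/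
theorem boostedKerr_time_relabel (M a : ℝ) (x : E4) :
    (boostedKerrBackground (L⁻¹ * Λ) ((L : E4 ≃L[ℝ] E4).symm (c - p)) M a).time x =
      (boostedKerrBackground Λ c M a).time ((L : E4 ≃L[ℝ] E4) x + p) := by
  simp only [boostedKerrBackground, poincareInv_relabel]

/-- Rest-frame Kerr–Schild radius of the relabelled background = old radius after `P`; in particular
the Voronoi cells `{rᵢ ≤ rⱼ}` of a relabelled input are the `P`-preimages of the old cells. [folklore] -/
theorem boostedKerr_radius_relabel (M a : ℝ) (x : E4) :
    (boostedKerrBackground (L⁻¹ * Λ) ((L : E4 ≃L[ℝ] E4).symm (c - p)) M a).radius x =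
      (boostedKerrBackground Λ c M a).radius ((L : E4 ≃L[ℝ] E4) x + p) := by
  simp only [boostedKerrBackground, poincareInv_relabel]

/-- The relabelled exterior domain is the `P`-preimage of the old one. [folklore] -/
theorem mem_boostedKerrExterior_relabel (M a : ℝ) (x : E4) :
    x ∈ boostedKerrExterior (L⁻¹ * Λ) ((L : E4 ≃L[ℝ] E4).symm (c - p)) M a ↔
      (L : E4 ≃L[ℝ] E4) x + p ∈ boostedKerrExterior Λ c M a := by
  simp only [mem_boostedKerrExterior, poincareInv_relabel]

/-- The relabelled reference form is the `(L × L)`-pullback of the old one after `P`: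
`g_{(L⁻¹Λ, L⁻¹(c−p))}(x)(v, w) = g_{(Λ,c)}(L x + p)(L v, L w)` — so a chart `Ψ ∘ P` deviates from the
relabelled background by the `(L × L)`-pullback of the deviation of `Ψ` from the old one (Kerr–Schild
1965, Lorentz covariance of the ansatz). [cite: KerrSchild1965, (Lorentz covariance of the Kerr–Schild a] -/
theorem boostedKerrBilin_relabel (M a : ℝ) (x v w : E4) :
    boostedKerrBilin (L⁻¹ * Λ) ((L : E4 ≃L[ℝ] E4).symm (c - p)) M a x v w =
      boostedKerrBilin Λ c M a ((L : E4 ≃L[ℝ] E4) x + p) ((L : E4 ≃L[ℝ] E4) v)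
        ((L : E4 ≃L[ℝ] E4) w) := by
  rw [boostedKerrBilin_apply, boostedKerrBilin_apply, poincareInv_relabel]
  have h1 : ∀ u : E4, (((L⁻¹ * Λ : lorentzGroup) : E4 ≃L[ℝ] E4).symm) u =
      (Λ : E4 ≃L[ℝ] E4).symm ((L : E4 ≃L[ℝ] E4) u) := fun u ↦ rfl
  rw [h1, h1]

end Covariance

end Summit.FinalStateConjecture.FinalStateConjecture.Theorems.GapDecaySuffices.Negative

end
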